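import Summits.Ventures.PackingBounds.Energy.TenPointCkNine
import Summits.Ventures.PackingBounds.Energy.GramCongrFaces
import Summits.Ventures.PackingBounds.Energy.ThreePointEnergyDeficit
import HarnessLib

/-!
# Ten points on `S³`, potential `(1+⟪x,y⟫)^9`: every minimiser is a `{1/6, -2/3}`-code (rigidity from the SOS face)

Framing: lottery ticket; floor = certified bounds/negative ranges. Venture `PackingBounds`, cell
`pub-packcert`, energy family E3PT (pub-packcert-energy gen 13; n = 4 kernel route = KERNEL-D6 data route + `threePointF 4`).

If ten unit vectors `C ⊂ ℝ⁴` attain `Σ_{x≠y} (1+⟪x,y⟫)^9 = 201769315/839808`, the deficit identity (`ThreePointDeficit.energy_sub_bound_eq`)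
makes the slack of the three-point inequality vanish at every ordered triple of distinct points; the slack is `(1/K)·mᵀ X m`
(`slack_bridgeT9`), `X = P (S·Y) Pᵀ` with `S·Y ≻ 0` WITH MARGIN (`GramData.checkDDm`, kernel), so every face form `Σ_a P_{ai} m_a` vanishes
(`GramData.faces_vanish_of_congr`); the face-basis vector read off column 0 of the data (`GramData.checkCol`) is the univariate
`(t - 1/6)(t + 2/3)`, so every inner product of distinct points is `1/6` or `-2/3`: a minimiser is a ten-point `{1/6, -2/3}`-code in `ℝ⁴`,
hence the Petersen code (`Config.PetersenCodeUnique.isometric`, companion file `TenPointCkNineGroundState`).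
-/

noncomputable section

open Finset
open scoped RealInnerProductSpace

namespace Summit.Ventures.PackingBounds.Energy.TenPointCkNine

open Literature.Geometry.DiscreteGeometry Literature.Geometry.DiscreteGeometry.BachocVallentin
open Literature.Analysis.SpecialFunctions
open Summit.Ventures.PackingBounds.Energy.GramData Summit.Ventures.PackingBounds.Energy.PetersenNineD6

set_option maxRecDepth 100000 in
/-- The remainder `E` of `S·Y = L Lᵀ + E` is diagonally dominant with margin `1` (kernel evaluation): `S·Y ≻ 0`. -/
theorem ddm_oneT9 : checkDDm 77 1 eP9 = true := by decide +kernel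

/-- Column 0 of the scaled face-basis matrix `bP9`: `46656·(t² + t/2 - 1/9)` on the monomials `1, t, t²`. -/
def faceColT9 : List ℤ := [-5184, 23328, 46656, 0, 0, 0, 0, 0, 0, 0, 0, 0, 0, 0, 0, 0, 0, 0, 0, 0, 0, 0, 0, 0, 0, 0, 0, 0, 0, 0, 0, 0, 0, 0, 0, 0, 0, 0, 0, 0, 0, 0, 0, 0, 0, 0, 0, 0, 0, 0, 0, 0, 0, 0, 0, 0, 0, 0, 0, 0, 0, 0, 0, 0, 0, 0, 0, 0, 0, 0, 0, 0, 0, 0, 0, 0, 0, 0, 0, 0, 0, 0, 0, 0]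

set_option maxRecDepth 100000 in
/-- `faceColT9` is column 0 of `bP9` (kernel evaluation). -/
theorem faceCol_okT9 : checkCol 84 bP9 0 faceColT9 = true := by decide +kernel

set_option maxRecDepth 100000 in
set_option maxHeartbeats 4000000 in
/-- If the monomial-side form `mᵀ X m` vanishes at `(u,v,t)`, then `(t - 1/6)(t + 2/3) = 0`. -/
theorem t_of_listQuad_eq_zeroT9 (u v t : ℝ) (h0 : listQuad (mvecT9 u v t) xP9 0 = 0) : t = 1 / 6 ∨ t = -2 / 3 := by
  have hXlen : xP9.length = 84 := by decide
  have hXrow : ∀ m, m < 84 → (xP9.getD m []).length = 84 := by decide +kernel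
  have hB : ∀ a, a < 84 → (bP9.getD a []).length = 77 := by decide +kernel
  have hv := faces_vanish_of_congr 84 77 77 1 le_rfl bP9 yP9 xP9 lP9 eP9 hXlen hXrow hB congrP9_all rowsP9_all
    (of_checkDDm ddm_oneT9) (mvecT9 u v t) h0 ⟨0, by norm_num⟩
  have hv' : ∑ a : Fin 84, (ent bP9 a 0 : ℝ) * mvecT9 u v t a = 0 := hv
  rw [sum_ent_eq_linForm faceCol_okT9 (by decide) (mvecT9 u v t)] at hv'
  simp only [linForm, faceColT9, mvecT9, Nat.reduceAdd, Int.cast_zero, zero_mul, zero_add, add_zero] at hv'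
  push_cast at hv'
  have hf : (t - 1 / 6) * (t + 2 / 3) = 0 := by linear_combination (1 / 46656 : ℝ) * hv'
  rcases mul_eq_zero.1 hf with h | h
  · left; linarith
  · right; linarith

/-- **Rigidity of the `(1+t)^9`-energy ground state of ten points on `S³`.** If ten unit vectors of `ℝ⁴` attain
`Σ_{x≠y} (1+⟪x,y⟫)^9 = 201769315/839808`, then every inner product of two distinct points is `1/6` or `-2/3`. -/
theorem ck9_ten_points_rigid (C : Finset (EuclideanSpace ℝ (Fin 4))) (hC : ∀ x ∈ C, ‖x‖ = 1)
    (h10 : C.card = 10)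
    (hmin : ∑ x ∈ C, ∑ y ∈ C.erase x, (1 + inner ℝ x y) ^ 9 = ((201769315 : ℝ)/839808)) :
    ∀ x ∈ C, ∀ y ∈ C, x ≠ y → inner ℝ x y = 1 / 6 ∨ inner ℝ x y = -2 / 3 := by
  classical
  have hA := pairSum_gegenbauer_comb_nonneg (n := 4) (by norm_num) 2 acoKT9 aco_nonnegT9 C hC
  have hF := tripleSum_threePointF_nonneg (n := 4) le_rfl 6 6 dcoKT9 dco_nonnegT9 gwKT9 C hC
  have hcard : (C.card : ℝ) = 10 := by exact_mod_cast h10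
  have hAeval : ∀ w : ℝ, (∑ k ∈ range (2 + 1), acoKT9 k * gegenbauerSum ((((4 : ℕ) : ℝ) - 2) / 2) k w) = aPolyKT9 w := by
    intro w
    have h0 : acoKT9 0 = 0 := rfl
    have h1 : acoKT9 1 = a1KT9 / 2 := rfl
    have h2 : acoKT9 2 = a2KT9 / 3 := rfl
    simp only [Finset.sum_range_succ, Finset.sum_range_zero, h0, h1, h2, gegenbauerSum_zero, gegenbauerSum_one, gegenbauerSum_two, aPolyKT9]
    push_cast
    ring
  have hineq : ∀ u v t : ℝ, -1 ≤ u → u < 1 → -1 ≤ v → v < 1 → -1 ≤ t → t < 1 →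
      0 ≤ 1 + 2 * u * v * t - u ^ 2 - v ^ 2 - t ^ 2 →
      c0KT9 + ((C.card : ℝ) - 2) * threePointF 4 6 6 dcoKT9 gwKT9 u v t + threePointF 4 6 6 dcoKT9 gwKT9 u u 1
        + threePointF 4 6 6 dcoKT9 gwKT9 v v 1 + threePointF 4 6 6 dcoKT9 gwKT9 t t 1
        + ((fun w => ∑ k ∈ range (2 + 1), acoKT9 k * gegenbauerSum ((((4 : ℕ) : ℝ) - 2) / 2) k w) u
          + (fun w => ∑ k ∈ range (2 + 1), acoKT9 k * gegenbauerSum ((((4 : ℕ) : ℝ) - 2) / 2) k w) v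
          + (fun w => ∑ k ∈ range (2 + 1), acoKT9 k * gegenbauerSum ((((4 : ℕ) : ℝ) - 2) / 2) k w) t) / 3
        ≤ (pminKT9 u + pminKT9 v + pminKT9 t) / 3 := by
    intro u v t hu1 hu2 hv1 hv2 ht1 ht2 hdet
    simp only [hAeval, hcard, threePointF_eqT9]
    have h1 := slack_nonnegT9 u v t
    linarith
  have hEp : ∑ x ∈ C, ∑ y ∈ C.erase x, pminKT9 (inner ℝ x y) = ((201769315 : ℝ)/839808) := by
    rw [← hmin]
    refine Finset.sum_congr rfl fun x _ => Finset.sum_congr rfl fun y _ => ?_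
    simp only [pminKT9]; ring
  have hsharp : ∑ x ∈ C, ∑ y ∈ C.erase x, pminKT9 (inner ℝ x y)
      = (C.card : ℝ) * (((C.card : ℝ) - 1) * c0KT9 - threePointF 4 6 6 dcoKT9 gwKT9 1 1 1 - (fun w => ∑ k ∈ range (2 + 1), acoKT9 k * gegenbauerSum ((((4 : ℕ) : ℝ) - 2) / 2) k w) 1) := by
    simp only [hAeval, hcard, threePointF_eqT9]
    rw [hEp, ← bound_eqT9]
  obtain ⟨hA0, hF0⟩ := ThreePointDeficit.pairSum_eq_zero_of_sharp C hC (by omega) pminKT9 _ _ c0KT9 hA hF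
    (threePointF_swap12 4 6 6 dcoKT9 gwKT9) (threePointF_swap23 4 6 6 dcoKT9 gwKT9) hineq hsharp
  have hid := ThreePointDeficit.energy_sub_bound_eq C hC (by omega) pminKT9 (fun w => ∑ k ∈ range (2 + 1), acoKT9 k * gegenbauerSum ((((4 : ℕ) : ℝ) - 2) / 2) k w)
    (threePointF 4 6 6 dcoKT9 gwKT9) c0KT9
    (threePointF_swap12 4 6 6 dcoKT9 gwKT9) (threePointF_swap23 4 6 6 dcoKT9 gwKT9)
  rw [hsharp, sub_self, hA0, hF0, add_zero, add_zero] at hid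
  have hrange : ∀ x ∈ C, ∀ y ∈ C, x ≠ y → -1 ≤ inner ℝ x y ∧ inner ℝ x y < 1 := by
    intro x hx y hy hxy
    refine ⟨neg_one_le_real_inner_of_norm_eq_one (hC x hx) (hC y hy),
      lt_of_le_of_ne (real_inner_le_one_of_norm_eq_one (hC x hx) (hC y hy)) ?_⟩
    intro h1
    exact hxy ((inner_eq_one_iff_of_norm_eq_one (𝕜 := ℝ) (hC x hx) (hC y hy)).1 h1)
  set T : EuclideanSpace ℝ (Fin 4) → EuclideanSpace ℝ (Fin 4) → EuclideanSpace ℝ (Fin 4) → ℝ :=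
    fun x y z => ((pminKT9 (inner ℝ x y) + pminKT9 (inner ℝ x z) + pminKT9 (inner ℝ y z))
        - (3 * c0KT9 + 3 * (((C.card : ℝ) - 2) * threePointF 4 6 6 dcoKT9 gwKT9 (inner ℝ x y) (inner ℝ x z) (inner ℝ y z))
          + 3 * (threePointF 4 6 6 dcoKT9 gwKT9 (inner ℝ x y) (inner ℝ x y) 1
            + threePointF 4 6 6 dcoKT9 gwKT9 (inner ℝ x z) (inner ℝ x z) 1
            + threePointF 4 6 6 dcoKT9 gwKT9 (inner ℝ y z) (inner ℝ y z) 1)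
          + ((fun w => ∑ k ∈ range (2 + 1), acoKT9 k * gegenbauerSum ((((4 : ℕ) : ℝ) - 2) / 2) k w) (inner ℝ x y)
            + (fun w => ∑ k ∈ range (2 + 1), acoKT9 k * gegenbauerSum ((((4 : ℕ) : ℝ) - 2) / 2) k w) (inner ℝ x z)
            + (fun w => ∑ k ∈ range (2 + 1), acoKT9 k * gegenbauerSum ((((4 : ℕ) : ℝ) - 2) / 2) k w) (inner ℝ y z))))
    with hTdef
  have hTnn : ∀ x ∈ C, ∀ y ∈ C.erase x, ∀ z ∈ (C.erase x).erase y, 0 ≤ T x y z := by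
    intro x hx y hy z hz
    have hyC : y ∈ C := Finset.mem_of_mem_erase hy
    have hxy : x ≠ y := fun h => (Finset.ne_of_mem_erase hy) h.symm
    have hz1 : z ∈ C.erase x := Finset.mem_of_mem_erase hz
    have hzC : z ∈ C := Finset.mem_of_mem_erase hz1
    have hzy : z ≠ y := Finset.ne_of_mem_erase hz
    have hzx : z ≠ x := Finset.ne_of_mem_erase hz1
    obtain ⟨lo1, hi1⟩ := hrange x hx y hyC hxy
    obtain ⟨lo2, hi2⟩ := hrange x hx z hzC hzx.symm
    obtain ⟨lo3, hi3⟩ := hrange y hyC z hzC hzy.symm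
    have h0 := hineq _ _ _ lo1 hi1 lo2 hi2 lo3 hi3
      (BachocVallentin.gram3_nonneg x y z (hC x hx) (hC y hyC) (hC z hzC))
    simp only [hTdef]
    linarith
  have hSum0 : ∑ x ∈ C, ∑ y ∈ C.erase x, ∑ z ∈ (C.erase x).erase y, T x y z = 0 := by
    have hpos : (0 : ℝ) < 1 / (3 * ((C.card : ℝ) - 2)) := by rw [hcard]; norm_num
    have h := hid.symm
    simp only [hTdef]
    rcases mul_eq_zero.1 h with h1 | h1
    · exact absurd h1 hpos.ne'
    · exact h1
  have hT0 : ∀ x ∈ C, ∀ y ∈ C.erase x, ∀ z ∈ (C.erase x).erase y, T x y z = 0 := by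
    have h1 := (Finset.sum_eq_zero_iff_of_nonneg (fun x hx =>
      Finset.sum_nonneg fun y hy => Finset.sum_nonneg fun z hz => hTnn x hx y hy z hz)).1 hSum0
    intro x hx
    have h2 := (Finset.sum_eq_zero_iff_of_nonneg (fun y hy =>
      Finset.sum_nonneg fun z hz => hTnn x hx y hy z hz)).1 (h1 x hx)
    intro y hy
    exact (Finset.sum_eq_zero_iff_of_nonneg (fun z hz => hTnn x hx y hy z hz)).1 (h2 y hy)
  intro y hy z hz hyz
  have hcard3 : 0 < ((C.erase y).erase z).card := by
    rw [Finset.card_erase_of_mem (Finset.mem_erase.2 ⟨fun h => hyz h.symm, hz⟩),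
      Finset.card_erase_of_mem hy, h10]; norm_num
  obtain ⟨x, hx⟩ := Finset.card_pos.1 hcard3
  have hx1 : x ∈ C.erase y := Finset.mem_of_mem_erase hx
  have hxC : x ∈ C := Finset.mem_of_mem_erase hx1
  have hxz : x ≠ z := Finset.ne_of_mem_erase hx
  have hxy : x ≠ y := Finset.ne_of_mem_erase hx1
  have hy' : y ∈ C.erase x := Finset.mem_erase.2 ⟨fun h => hxy h.symm, hy⟩
  have hz' : z ∈ (C.erase x).erase y := Finset.mem_erase.2 ⟨fun h => hyz h.symm, Finset.mem_erase.2 ⟨fun h => hxz h.symm, hz⟩⟩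
  have hT := hT0 x hxC y hy' z hz'
  simp only [hTdef, hAeval, hcard, threePointF_eqT9] at hT
  set u := inner ℝ x y with hu
  set v := inner ℝ x z with hv
  set t := inner ℝ y z with ht
  have hs : (pminKT9 u + pminKT9 v + pminKT9 t) / 3 - (c0KT9 + 8 * FexpKT9 u v t + FexpKT9 u u 1 + FexpKT9 v v 1 + FexpKT9 t t 1
      + (aPolyKT9 u + aPolyKT9 v + aPolyKT9 t) / 3) = 0 := by
    linarith [hT]
  have hb := slack_bridgeT9 u v t
  rw [hs, mul_zero] at hb
  exact t_of_listQuad_eq_zeroT9 u v t hb.symm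

end Summit.Ventures.PackingBounds.Energy.TenPointCkNine
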